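import Literature.AlgebraicGeometry.ComplexMultiplication.EndAlgebraCentralDegreeSquare
import Literature.AlgebraicGeometry.ComplexMultiplication.FieldOfDegreeTwoDimIsotypic
import HarnessLib

/-!
# Simple complex abelian fourfolds with an imaginary central endomorphism: Albert's table read at `g = 4`

D. Mumford, *Abelian Varieties* (1970), §21 (pp. 201–202): for `X` simple, `D = End⁰(X)`, `K` the centre of `D`,
`e = [K:ℚ]`, `d² = [D:K]`, and in characteristic `0` the divisibilities Type I `e ∣ g`, Types II/III `2e ∣ g`, Type IV
`e d² ∣ 2g` (the tree: `exists_sq_mul_finrank_center_dvd_two_mul_dim`, «`d² e ∣ 2 dim B`»).  B. Moonen, Yu. Zarhin,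
Math. Ann. **315** (1999) §1 (1.1) and the `g = 4` paragraph of §2 (held `paper:arxiv-math_9901113`, chunk p0005:
«The case `g = 4` is more involved and was studied in [MZ95] …»; case (g) of Thm. 0.2: «a simple abelian fourfold such
that there exists an embedding `k ↪ End⁰(X₂)` via which `k` acts on `T_{X₂,0}` with multiplicities `(1,3)`»).

THIS FILE reads the table at `g = 4` for a simple fourfold `B` whose endomorphism algebra has a CENTRAL element `z` with
`z² = -n`, `n > 0` (an imaginary quadratic field `k = ℚ(z)` inside the centre — the situation of Moonen–Zarhin's case
(g)): `z` is not a rational scalar, so `e = [Z(End⁰ B):ℚ] ≥ 2`, and `d² e ∣ 8` leaves exactly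
`(d, e) ∈ {(1,2), (1,4), (1,8), (2,2)}`:

* `finrank_center_endAlgebra_ne_one_of_mul_self_eq_neg` — `[Z(End⁰ B):ℚ] ≠ 1`.
* **`finrank_endAlgebra_of_dim_eq_four_of_center_mul_self_eq_neg`** — `[End⁰(B):ℚ] = 2` (then `End⁰(B) = k`), or
  `[End⁰(B):ℚ] = 4` with `End⁰(B)` commutative (a quartic field `⊋ k`, Type IV(2,1)), or `[End⁰(B):ℚ] = 8` with
  `End⁰(B)` commutative (an octic CM field: `B` of CM type, Type IV(4,1)), or `[End⁰(B):ℚ] = 8` with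
  `[Z(End⁰ B):ℚ] = 2` (a quaternion algebra over `k`, Type IV with `d = 2`).
* `isField_endAlgebra_of_center_eq_top` — a simple `B` with commutative `End⁰(B)` has `End⁰(B)` a field (Mumford §19
  Cor. 2); `isOfCMType_of_finrank_center_eq_two_mul_dim` — `[Z(End⁰ B):ℚ] = 2 dim B` makes `B` of CM type.
* **`isField_or_finrank_eq_eight_of_dim_eq_four_of_not_isOfCMType`** — for `B` NOT of CM type with `[End⁰(B):ℚ] ≠ 2`:
  `End⁰(B)` is a quartic FIELD containing `k`, or `[End⁰(B):ℚ] = 8` with centre of degree `2`; and the same with the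
  central square root given as a morphism `φ : B ⟶ B`, `φ ≫ φ = -n` (`…_of_hom`), the spelling of the residual of
  case (g) in `Summits/HodgeConjecture/Ring2/NonSimpleFivefoldsCodimTwo`.

Family `hodge`; Literature lane of the cell `pub-hodge-ring2` (HONEST FRAMING: research route conditional on HC_CM;
not a corollary; Q11.4-sentence-2 already refuted in dim ≥ 3).  UNCONDITIONAL; theorems only (no definition, no named
fact, no `sorry`); nothing here is a step towards a summit statement beyond the printed classification it reads.

## References
* [MumfordAV1970] D. Mumford, *Abelian Varieties* (1970), §19 Cor. 2 of Thm. 1 (p. 174), §21 (pp. 201–202).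
* [MoonenZarhin1999LowDim] B. Moonen, Yu. Zarhin, Math. Ann. 315 (1999) 711–733, §1 (1.1), §2 (`g = 4`), Thm. 0.2
  case (g).
* [LangeBirkenhake1992] Ch. Birkenhake, H. Lange, *Complex Abelian Varieties*, §5.5 Prop. 5.5.7.
* [Shimura1998] G. Shimura, *Abelian Varieties with Complex Multiplication and Modular Functions*, §5.1 Props. 3–4.
-/

noncomputable section

open CategoryTheory

namespace Literature.AlgebraicGeometry.ComplexMultiplication

open Literature.AlgebraicGeometry.Motives Literature.AlgebraicGeometry.HodgeTheory
open Literature.AlgebraicGeometry.Milne1999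

variable {B : AbelianVariety ℂ}

/-! ### §1 A central square root of a negative rational is not a scalar -/

/-- **`[Z(End⁰ B):ℚ] ≠ 1` as soon as the centre contains `z` with `z² = -n`, `n > 0`**: if the centre were the line
`ℚ · 1`, then `z = q · 1` and `q² = -n < 0` in `ℚ`. [cite: MumfordAV1970, §21 (pp. 201–202)]
[cite: MoonenZarhin1999LowDim, §1 (1.1)] -/
theorem finrank_center_endAlgebra_ne_one_of_mul_self_eq_neg (hB0 : 0 < B.dim) {z : B.endAlgebra}
    (hz : z ∈ Subalgebra.center ℚ B.endAlgebra) {n : ℕ} (hn : 0 < n) (hzz : z * z = -((n : ℚ) • 1)) :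
    Module.finrank ℚ (Subalgebra.center ℚ B.endAlgebra) ≠ 1 := by
  haveI : Nontrivial B.endAlgebra := nontrivial_endAlgebra_of_dim_pos hB0
  intro h1
  have hone : (⟨1, Subalgebra.one_mem _⟩ : Subalgebra.center ℚ B.endAlgebra) ≠ 0 := fun h =>
    one_ne_zero (congrArg Subtype.val h)
  obtain ⟨q, hq⟩ := (finrank_eq_one_iff_of_nonzero' _ hone).1 h1 ⟨z, hz⟩
  have hq' : (q : ℚ) • (1 : B.endAlgebra) = z := congrArg Subtype.val hq
  have hzz' : (q * q) • (1 : B.endAlgebra) = -((n : ℚ) • 1) := by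
    rw [← hzz, ← hq', smul_mul_smul_comm, mul_one]
  have hsq : ((q * q + n : ℚ)) • (1 : B.endAlgebra) = 0 := by
    rw [add_smul, hzz', neg_add_cancel]
  have hqn : (q * q + n : ℚ) = 0 := (smul_eq_zero.1 hsq).resolve_right one_ne_zero
  nlinarith [mul_self_nonneg q, (Nat.cast_pos (α := ℚ)).2 hn]

/-! ### §2 The table at `g = 4` -/

/-- **Simple complex abelian FOURFOLDS with an imaginary central element — Albert's table.**  Let `B` be simple of
dimension `4` and `z ∈ Z(End⁰ B)` with `z² = -n`, `n > 0`.  Then (`[End⁰(B):ℚ] = d² e`, `d² e ∣ 8`, `e ≥ 2`):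
`[End⁰(B):ℚ] = 2`; or `[End⁰(B):ℚ] = 4` and `End⁰(B)` is its own centre; or `[End⁰(B):ℚ] = 8` and `End⁰(B)` is its
own centre; or `[End⁰(B):ℚ] = 8` and `[Z(End⁰ B):ℚ] = 2`. [cite: MumfordAV1970, §21 (pp. 201–202)]
[cite: MoonenZarhin1999LowDim, §1 (1.1) and §2 (g = 4)] [cite: LangeBirkenhake1992, §5.5 Prop. 5.5.7] -/
theorem finrank_endAlgebra_of_dim_eq_four_of_center_mul_self_eq_neg (hB : AbelianVariety.IsSimple B)
    (h4 : B.dim = 4) {z : B.endAlgebra} (hz : z ∈ Subalgebra.center ℚ B.endAlgebra) {n : ℕ} (hn : 0 < n)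
    (hzz : z * z = -((n : ℚ) • 1)) :
    Module.finrank ℚ B.endAlgebra = 2 ∨
      (Module.finrank ℚ B.endAlgebra = 4 ∧ Subalgebra.center ℚ B.endAlgebra = ⊤) ∨
      (Module.finrank ℚ B.endAlgebra = 8 ∧ Subalgebra.center ℚ B.endAlgebra = ⊤) ∨
      (Module.finrank ℚ B.endAlgebra = 8 ∧ Module.finrank ℚ (Subalgebra.center ℚ B.endAlgebra) = 2) := by
  haveI : Module.Finite ℚ B.endAlgebra := AbelianVariety.finiteDimensional_endAlgebra_holds B
  have hB0 : 0 < B.dim := by omega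
  have he1 := finrank_center_endAlgebra_ne_one_of_mul_self_eq_neg hB0 hz hn hzz
  obtain ⟨d, hd, h, hdvd⟩ := exists_sq_mul_finrank_center_dvd_two_mul_dim hB hB0
  have htop : Module.finrank ℚ B.endAlgebra = Module.finrank ℚ (Subalgebra.center ℚ B.endAlgebra) →
      Subalgebra.center ℚ B.endAlgebra = ⊤ := center_eq_top_of_finrank_eq
  generalize he : Module.finrank ℚ (Subalgebra.center ℚ B.endAlgebra) = e at *
  rw [h4, show 2 * 4 = 8 by norm_num] at hdvd
  have hle : d ^ 2 * e ≤ 8 := Nat.le_of_dvd (by norm_num) hdvd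
  have he0 : e ≠ 0 := by
    rintro rfl
    rw [mul_zero] at hdvd
    exact absurd (zero_dvd_iff.1 hdvd) (by norm_num)
  have he2 : 2 ≤ e := by omega
  have hd2 : d ≤ 2 := by
    by_contra hlt
    have h9 : 3 ^ 2 * 2 ≤ d ^ 2 * e := Nat.mul_le_mul (Nat.pow_le_pow_left (by omega) 2) he2
    omega
  have hcases : (d = 1 ∧ (e = 2 ∨ e = 4 ∨ e = 8)) ∨ (d = 2 ∧ e = 2) := by
    interval_cases d
    · refine Or.inl ⟨rfl, ?_⟩
      rw [one_pow, one_mul] at hdvd hle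
      interval_cases e <;> omega
    · refine Or.inr ⟨rfl, ?_⟩
      norm_num at hle
      omega
  rcases hcases with ⟨rfl, rfl | rfl | rfl⟩ | ⟨rfl, rfl⟩ <;> norm_num at h
  · exact Or.inl h
  · exact Or.inr (Or.inl ⟨h, htop h⟩)
  · exact Or.inr (Or.inr (Or.inl ⟨h, htop h⟩))
  · exact Or.inr (Or.inr (Or.inr ⟨h, rfl⟩))

/-! ### §3 Consequences: commutative `End⁰` is a field; centre of degree `2 dim` means CM type -/

/-- **A simple `B` whose `End⁰` is its own centre has `End⁰(B)` a FIELD** (commutative, and every non-zero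
endomorphism of a simple abelian variety is invertible in `End⁰`, Mumford §19 Cor. 2 — the tree's
`endAlgebra_exists_inv_of_isSimple`). [cite: MumfordAV1970, §19 Cor. 2 of Thm. 1 (p. 174)] -/
theorem isField_endAlgebra_of_center_eq_top (hB : AbelianVariety.IsSimple B) (hB0 : 0 < B.dim)
    (htop : Subalgebra.center ℚ B.endAlgebra = ⊤) : IsField B.endAlgebra := by
  haveI : Nontrivial B.endAlgebra := nontrivial_endAlgebra_of_dim_pos hB0
  exact { exists_pair_ne := exists_pair_ne B.endAlgebra
          mul_comm := fun x y =>
            (Subalgebra.mem_center_iff.1 (show x ∈ Subalgebra.center ℚ B.endAlgebra from htop ▸ Algebra.mem_top) y).symm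
          mul_inv_cancel := fun ha => by
            obtain ⟨b, hab, -⟩ := endAlgebra_exists_inv_of_isSimple hB _ ha
            exact ⟨b, hab⟩ }

/-- **A simple `B` with `[Z(End⁰ B):ℚ] = 2 dim B` is of CM type**: the centre is a (commutative) field of degree
`2 dim B` inside `End⁰(B)` (`isField_center_endAlgebra`, `isOfCMType_of_isField`). [cite: Shimura1998, §5.1 Props. 3–4]
[cite: MumfordAV1970, §21 (pp. 201–202)] -/
theorem isOfCMType_of_finrank_center_eq_two_mul_dim (hB : AbelianVariety.IsSimple B) (hB0 : 0 < B.dim)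
    (he : Module.finrank ℚ (Subalgebra.center ℚ B.endAlgebra) = 2 * B.dim) : IsOfCMType B :=
  isOfCMType_of_isField (Subalgebra.center ℚ B.endAlgebra) (isField_center_endAlgebra hB hB0) he

/-! ### §4 The non-CM residual of case (g): a quartic field or a quaternion algebra over `k` -/

/-- **The non-CM members of Moonen–Zarhin's case (g), endomorphism side.**  A simple complex abelian fourfold `B` NOT
of CM type with a central `z`, `z² = -n` (`n > 0`), and `[End⁰(B):ℚ] ≠ 2` has either `End⁰(B)` a quartic FIELD (then
`⊋ k = ℚ(z)`: Type IV(2,1)) or `[End⁰(B):ℚ] = 8` with `[Z(End⁰ B):ℚ] = 2` (a quaternion algebra over its centre `k`,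
Type IV with `d = 2`); the octic-centre cell is excluded because it is CM type. [cite: MumfordAV1970, §21 (pp. 201–202)]
[cite: MoonenZarhin1999LowDim, §2 (g = 4) and Thm. 0.2 case (g)] -/
theorem isField_or_finrank_eq_eight_of_dim_eq_four_of_not_isOfCMType (hB : AbelianVariety.IsSimple B)
    (h4 : B.dim = 4) (hcm : ¬ IsOfCMType B) {z : B.endAlgebra} (hz : z ∈ Subalgebra.center ℚ B.endAlgebra)
    {n : ℕ} (hn : 0 < n) (hzz : z * z = -((n : ℚ) • 1)) (h2 : Module.finrank ℚ B.endAlgebra ≠ 2) :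
    (IsField B.endAlgebra ∧ Module.finrank ℚ B.endAlgebra = 4) ∨
      (Module.finrank ℚ B.endAlgebra = 8 ∧ Module.finrank ℚ (Subalgebra.center ℚ B.endAlgebra) = 2) := by
  have hB0 : 0 < B.dim := by omega
  rcases finrank_endAlgebra_of_dim_eq_four_of_center_mul_self_eq_neg hB h4 hz hn hzz with
    h | ⟨h, htop⟩ | ⟨h, htop⟩ | h
  · exact absurd h h2
  · exact Or.inl ⟨isField_endAlgebra_of_center_eq_top hB hB0 htop, h⟩
  · refine absurd (isOfCMType_of_finrank_center_eq_two_mul_dim hB hB0 ?_) hcm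
    rw [htop, h4]
    haveI : Module.Finite ℚ B.endAlgebra := AbelianVariety.finiteDimensional_endAlgebra_holds B
    rw [show Module.finrank ℚ (⊤ : Subalgebra ℚ B.endAlgebra) = Module.finrank ℚ B.endAlgebra from
      (Subalgebra.topEquiv (R := ℚ) (A := B.endAlgebra)).toLinearEquiv.finrank_eq, h]
  · exact Or.inr h

/-- **The same with the central square root given as a morphism** `φ : B ⟶ B`, `φ ≫ φ = -(n • 𝟙 B)`, whose class in
`End⁰(B)` is central — the spelling of the residual of case (g) in the cell's census
(`Summits/HodgeConjecture/Ring2/NonSimpleFivefoldsCodimTwo`). [cite: MumfordAV1970, §21 (pp. 201–202)]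
[cite: MoonenZarhin1999LowDim, Thm. 0.2 case (g)] -/
theorem isField_or_finrank_eq_eight_of_dim_eq_four_of_not_isOfCMType_of_hom (hB : AbelianVariety.IsSimple B)
    (h4 : B.dim = 4) (hcm : ¬ IsOfCMType B) (φ : B ⟶ B) {n : ℕ} (hn : 0 < n) (hφ : φ ≫ φ = -(n • 𝟙 B))
    (hφZ : AbelianVariety.endAlgebra.of B φ ∈ Subalgebra.center ℚ B.endAlgebra)
    (h2 : Module.finrank ℚ B.endAlgebra ≠ 2) :
    (IsField B.endAlgebra ∧ Module.finrank ℚ B.endAlgebra = 4) ∨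
      (Module.finrank ℚ B.endAlgebra = 8 ∧ Module.finrank ℚ (Subalgebra.center ℚ B.endAlgebra) = 2) := by
  refine isField_or_finrank_eq_eight_of_dim_eq_four_of_not_isOfCMType hB h4 hcm hφZ hn ?_ h2
  set φ' : End B := φ with hφ'
  have h : φ' * φ' = -(n • (1 : End B)) := hφ
  rw [← map_mul, h, map_neg, map_nsmul, map_one, Nat.cast_smul_eq_nsmul]

end Literature.AlgebraicGeometry.ComplexMultiplication

end
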